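import Summits.QuantumFields.QCD.Theorems.QuarksAsStableActionCriticalLineDiamagnetismCellSecondOrderDefs

/-!
# Definitions for the cell sub-stub `cellFirstOrder` (B6 of line `Sketch`, crux stmt-QuantumFields-9734)

Crux `Summit.QuantumFields.QCD.Theses.QuarksAsStableAction.CriticalLineDiamagnetism` (item stmt-QuantumFields-9734,
sub-problem `Summits/QuantumFields/QCD/Statement.lean`), line `Sketch`, Route B step B6: the registered cell sub-stub
`cellFirstOrder` of `stub_heavyFrequencyGain` (plan `S4-PLAN.md` §B6 of the line lead).

DEFINITIONS ONLY (the vocabulary of the files `…CellFreeKron`, `…CellFreeOnsite`, `…CellFreeSymm`, `…CellFreeAmplitude`,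
`…CellFreeWalks`, `…CellFirstOrder`).  The FREE rectangular frequency operator
`freeOp L₁ L₂ m ω₀ ω₁ = freqOpR γ 1 m ω₀ ω₁` on `ℤ/L₁ × ℤ/L₂` (trivial field, antiperiodic seams) is
`1 ⊗ 1 ⊗ N_ω − hopOp` with `N_ω = CellWalk.spinN M_ω (sin ω₀) (sin ω₁)` and the COLOUR-CARRYING hopping operator
`hopOp = S⁺ ⊗ 1₃ ⊗ P₋² + S⁻ ⊗ 1₃ ⊗ P₊² + U⁺ ⊗ 1₃ ⊗ P₋³ + U⁻ ⊗ 1₃ ⊗ P₊³` built from the four seam-signed site shifts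
`sfShift`, `sbShift` (first coordinate, forward/backward) and `ufShift`, `ubShift` (second coordinate).  `spinBlock A z y` is
the `4 × 4` spin block of an operator `A` on `sites × colour × spin` between the sites `z`, `y` at colour `(0,0)`.
(The sibling vocabulary `CellWalk.*` of `cellSecondOrder` works on the colour-stripped square torus; here the two lengths
and the colour index are kept, as the first-order identity needs the colour structure of `Cell.X`.)
-/

noncomputable section

open scoped BigOperators Matrix Kronecker
open Matrix Literature.MathematicalPhysics.QuantumLattice
open Summit.QuantumFields.QCD.Cruxes.CriticalLineDiamagnetism.ChessboardCellGain.FrequencyDiamagnetism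

namespace Summit.QuantumFields.QCD.Cruxes.CriticalLineDiamagnetism.ChessboardCellGain

namespace CellFO

/-- The seam-signed forward shift of the first coordinate: `S⁺(x, x + e₁) = σ₁(x)`, `σ₁ = −1` on the seam `x₁ = −1`. -/
def sfShift (L₁ L₂ : ℕ) : Matrix (ZMod L₁ × ZMod L₂) (ZMod L₁ × ZMod L₂) ℂ :=
  Matrix.of fun x y : ZMod L₁ × ZMod L₂ => if y = (x.1 + 1, x.2) then (if x.1 = -1 then (-1 : ℂ) else 1) else 0

/-- The seam-signed backward shift of the first coordinate: `S⁻(x + e₁, x) = σ₁(x)`. -/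
def sbShift (L₁ L₂ : ℕ) : Matrix (ZMod L₁ × ZMod L₂) (ZMod L₁ × ZMod L₂) ℂ :=
  Matrix.of fun x y : ZMod L₁ × ZMod L₂ => if x = (y.1 + 1, y.2) then (if y.1 = -1 then (-1 : ℂ) else 1) else 0

/-- The seam-signed forward shift of the second coordinate: `U⁺(x, x + e₂) = σ₂(x)`, `σ₂ = −1` on the seam `x₂ = −1`. -/
def ufShift (L₁ L₂ : ℕ) : Matrix (ZMod L₁ × ZMod L₂) (ZMod L₁ × ZMod L₂) ℂ :=
  Matrix.of fun x y : ZMod L₁ × ZMod L₂ => if y = (x.1, x.2 + 1) then (if x.2 = -1 then (-1 : ℂ) else 1) else 0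

/-- The seam-signed backward shift of the second coordinate: `U⁻(x + e₂, x) = σ₂(x)`. -/
def ubShift (L₁ L₂ : ℕ) : Matrix (ZMod L₁ × ZMod L₂) (ZMod L₁ × ZMod L₂) ℂ :=
  Matrix.of fun x y : ZMod L₁ × ZMod L₂ => if x = (y.1, y.2 + 1) then (if y.2 = -1 then (-1 : ℂ) else 1) else 0

/-- The colour-carrying free hopping operator `H = S⁺ ⊗ 1 ⊗ P₋² + S⁻ ⊗ 1 ⊗ P₊² + U⁺ ⊗ 1 ⊗ P₋³ + U⁻ ⊗ 1 ⊗ P₊³`. -/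
def hopOp (L₁ L₂ : ℕ) :
    Matrix ((ZMod L₁ × ZMod L₂) × Fin 3 × Fin 4) ((ZMod L₁ × ZMod L₂) × Fin 3 × Fin 4) ℂ :=
  sfShift L₁ L₂ ⊗ₖ ((1 : Matrix (Fin 3) (Fin 3) ℂ) ⊗ₖ CellKappa.pMinus 2) +
    sbShift L₁ L₂ ⊗ₖ ((1 : Matrix (Fin 3) (Fin 3) ℂ) ⊗ₖ CellKappa.pPlus 2) +
    ufShift L₁ L₂ ⊗ₖ ((1 : Matrix (Fin 3) (Fin 3) ℂ) ⊗ₖ CellKappa.pMinus 3) +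
    ubShift L₁ L₂ ⊗ₖ ((1 : Matrix (Fin 3) (Fin 3) ℂ) ⊗ₖ CellKappa.pPlus 3)

/-- The free rectangular frequency operator `freqOpR γ 1 m ω₀ ω₁` (trivial field) on `ℤ/L₁ × ℤ/L₂`. -/
def freeOp (L₁ L₂ : ℕ) (m ω₀ ω₁ : ℝ) :
    Matrix ((ZMod L₁ × ZMod L₂) × Fin 3 × Fin 4) ((ZMod L₁ × ZMod L₂) × Fin 3 × Fin 4) ℂ :=
  freqOpR euclideanGamma (fun (_ : ZMod L₁) (_ : ZMod L₂) (_ : Fin 4) => (1 : Matrix.unitaryGroup (Fin 3) ℂ)) m ω₀ ω₁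

/-- The `4 × 4` spin block of an operator on `sites × colour × spin` between the sites `z`, `y` at colour `(0, 0)`. -/
def spinBlock {T : Type} (A : Matrix (T × Fin 3 × Fin 4) (T × Fin 3 × Fin 4) ℂ) (z y : T) : Matrix (Fin 4) (Fin 4) ℂ :=
  Matrix.of fun i j : Fin 4 => A (z, 0, i) (y, 0, j)

end CellFO

/-- **Registered anchor `cellFreeOpEq`**: the free operator `Cell.D1 n` of the cell lemma IS `CellFO.freeOp (2n) (2n)`. -/
theorem cellFreeOpEq : ∀ (n : ℕ) [NeZero n] (m ω₀ ω₁ : ℝ), Cell.D1 n m ω₀ ω₁ = CellFO.freeOp (2 * n) (2 * n) m ω₀ ω₁ :=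
  fun _ _ _ _ _ => rfl

end Summit.QuantumFields.QCD.Cruxes.CriticalLineDiamagnetism.ChessboardCellGain

end
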